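import Summits.BirchSwinnertonDyer.Rank1Residual.Additive.GordThreeCycLowerCore
import Summits.BirchSwinnertonDyer.Rank1Residual.Additive.CycLeadingTermDvdIff
import Summits.BirchSwinnertonDyer.Rank1Residual.Additive.GordRankZeroChiBranch
import Summits.BirchSwinnertonDyer.Rank1Residual.AdditivePotMult.TamagawaAtP
import Literature.NumberTheory.EllipticCurves.ZywinaCMImageProofs
import Summits.BirchSwinnertonDyer.Rank1Residual.Additive.GordBranchPAdicGrossZagierOddConverseThree
import Summits.BirchSwinnertonDyer.Rank1Residual.Additive.QuadraticTwistTypeGOrd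
import Summits.BirchSwinnertonDyer.Rank1Residual.Additive.X4RankZeroQuadraticBranchLower
import HarnessLib

/-!
# U3 / ROUTE-IW: Iwasawa descent at an additive `p = 3` — the LOWER half `ord₃ #Ш_an ≤ ord₃ #Ш`
# on the potentially ORDINARY additive locus, rank `0`, UNIFORMLY modulo ONE named conjecture binder
# (cell `bsd-uniform`, seat u3-p1; DRAFT pending `u3/ROUTE-IW.md`)

HONEST FRAMING (cell `bsd-uniform`, run/shared/lean/pub/bsd-uniform/, verbatim in every file): the
goal of the cell is a CONDUCTOR-FREE BSD formula in analytic rank `≤ 1` via UNIFORM CLASS THEOREMS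
whose hypotheses are class predicates and PRINTED theorems, replacing per-curve certificates. THIS
FILE proves NO unconditional uniform theorem: every conclusion carries the OPEN binder
`Additive.CycLowerLeadingTermAt W 3` — the `T = 0`, Néron-period, integral LOWER divisibility of
Delbourgo's Main Conjecture at `3` (Compositio 113 (1998) p. 151; held text
`paper:delbourgo1998-iwasawa-theory-elliptic-curves-at-unstable-primes` p0029 L59–75: "MAIN CONJECTURE.
Assume that E is potentially ordinary at p and satisfies hypothesis (G) or (M). Then X_∞ … is
Λ-torsion. If G_E denotes its characteristic power series, then ι(T)G_E(T) = ℓ_p(E)·∫(1+T)^{x_p(g)}dμ_E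
for some ι ∈ Λ^×"), a CONJECTURE — NOT in print as a theorem, a route item, never a Literature fact
(referee V9); what IS proved is
that on the class below this one binder is EXACTLY what is missing (an `iff`, at the `Ш` level and at
the `BSD(E,3)` level). Reduction types covered: additive at `3`, potentially multiplicative
(`ord₃ j < 0`, Kodaira `I_n^*`) or potentially good ORDINARY of Delbourgo's type (G) (Kodaira `I₀*`
with ordinary twist; tame defect `e = 2` is automatic at `3`), analytic rank `0`. RESIDUE (named in
HOME/RESIDUE.md §U3): the ANOMALOUS (G)-rows (`3 ∣ #Ẽ(𝔽₃)` for the twist's reduction: slack `2`),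
the CM rows of the (G)-part when `ρ̄_{E,3}` is not surjective (Delbourgo 2002 excludes CM), the
potentially SUPERSINGULAR additive locus at `3` (`X(E/ℚ_∞)` not Λ-torsion: outside Iwasawa descent),
analytic rank `1` (Schneider rider + regulator valuation: per-curve), non-surjective `ρ̄_{E,3}` for the
`BSD(E,3)` closures. Rows of record the class covers (cell HOME `u3/WHY-NOT-3.md` §0 quoting b2b
RESIDUAL-MAP §I; counts quoted, not re-derived; vacuity pass): of N11's 192 277 `surj(3) ∧ r = 0`
sweep pairs, (M)@3 = 82 103 and (G-ord)@3 = 16 517 are potentially ordinary (the rest, 93 657, is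
potentially supersingular and outside this file); the binder `CycLowerLeadingTermAt W 3` quantifies over
Pontryagin-dual data which EXIST (`exists_cyclotomic_dualData_generator W 3`), so it is not vacuous.
No summit claim; nothing booked; no density number moves. Literature sheet the binders follow, page by
page: `u3/WHY-NOT-3.md` (u3-lit) §3 (Delbourgo AS PRINTED: nothing excludes the potentially-ordinary
locus at `3`), §3.3–3.4 (the '⊇' divisibility is printed nowhere; S–U Thm 1 = trivial branch, `p ∤ N`).

WHY THIS IS NOVEL (one sentence): the tree (cell b2b-bsdres, team n1011) holds the two Delbourgo cells
(M)@3 and (G-ord)@3 as separate end-state theorems with cell-specific binders; this file states the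
WHOLE potentially-ordinary additive locus at `3` as ONE uniform conditional theorem with a single
conjecture binder, discharges the non-CM binder from `surj(3)` (Zywina 2015 / Serre 1972), and proves
that binder EQUIVALENT both to `Typed.MissingLowerBoundAt W 3` and to `BSD(E,3)` on the class — so the
honest verdict of the IW lens is a theorem: "no lever short of the `T = 0` Eisenstein divisibility".

Sources (all inputs are explicit named-fact binders, typed AT `p = 3` in the tree): Delbourgo 1998,
Thm. 3, Prop. 4 (p. 144), §2.2 Lemma (ii) (p. 139), MC (p. 151) (`Delbourgo1998.prop4_rankZero_pow_dvd_constantCoeff`,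
`…_constantCoeff_eq_unit_mul_of_potMult`; "p an odd rational prime", p. 123); Delbourgo 2002 Theorem
(A), (B) (p. 40), Hypothesis second bullet (p. 39) (`Delbourgo2002.mainTheorem_three`); Kato 2004
Thm. 17.4 (3) (`Kato2004.charIdeal_dvd_padicLFunctionBranch_component_of_surjective`,
`Wuthrich2014.kato_minusEigenCharIdeal_dvd_cyclotomicThree_of_surjective`); GZK
(`rank_eq_analyticRank_of_analyticRank_le_one`); modularity (`hasEntireLFunction_rat`,
`nonempty_modularParametrizationData`); Zywina 2015 Prop. 1.14/1.16 (theorem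
`WeierstrassCurve.not_hasSurjectiveModNGaloisRep_of_hasCM`); R. L. Miller, LMS J. Comput. Math. 14
(2011) Def. 1.1 (`BSDp`, `Typed.MissingLowerBoundAt`). Theorems only (no `def`, no `sorry`).
-/

noncomputable section

open scoped Classical NumberField

open WeierstrassCurve NumberField IsDedekindDomain Rat.HeightOneSpectrum
  Literature.NumberTheory.EllipticCurves
  Literature.NumberTheory.EllipticCurves.ModularForms
  Literature.NumberTheory.EllipticCurves.Rank1Residual
  Literature.NumberTheory.EllipticCurves.Rank1Residual.Typed
  Summit.BirchSwinnertonDyer.Rank1Residual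
  Summit.BirchSwinnertonDyer.Rank1Residual.Additive

namespace Summit.BirchSwinnertonDyer.Uniform.U3

variable {W : WeierstrassCurve ℚ} [W.IsElliptic] [W.IsGloballyMinimal]

/-! ### §1 Class-predicate bookkeeping at `3` (theorems; the class is stated by its conjuncts
`Addv W 3 ∧ (Additive.PotMult W 3 ∨ TypeGOrd W 3)` — the N10 locus at `3`, `N10.Locus W 3` minus
its idle conjunct `3 ≠ 2`) -/

/-- **On the potentially-ordinary additive locus at `3` the local Tamagawa number `c₃(E)` is prime
to `3`** (Kodaira `I_n^*` on (M), `I₀*` on (G): `c₃ ∈ {1, 2, 4}`) — the binder `3 ∤ c₃` of the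
converse direction is a theorem on the class. [cite: SilvermanATAEC1994, IV.9.4 Steps 6–7] -/
theorem not_dvd_tamagawaNumberAt_three_of_potOrd [hp : Fact (Nat.Prime 3)] (hadd : Addv W 3)
    (hord : Additive.PotMult W 3 ∨ TypeGOrd W 3) :
    ¬ 3 ∣ W.tamagawaNumberAt ((primesEquiv (R := 𝓞 ℚ)).symm ⟨3, hp.out⟩) := by
  rcases hord with hM | hG
  · exact AdditivePotMult.PotMult.not_dvd_tamagawaNumberAt (W := W) (p := 3) ⟨hadd, hM⟩ (by decide)
  · exact TypeGOrd.not_dvd_tamagawaNumberAt_of_semistabilityIndex_eq_two W 3 (by decide) hG hadd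
      (semistabilityIndex_eq_two_of_typeG_three W hG.typeG hadd)

omit [W.IsGloballyMinimal] in
/-- **`surj(3)` discharges Delbourgo's "no complex multiplication"**: a curve with surjective
`ρ̄_{E,3}` has no CM (Zywina 2015 Prop. 1.14/1.16; Serre 1972 §4.5: the mod-`ℓ` image of a CM curve
normalises a Cartan subgroup or is reducible, for every odd `ℓ`).
[cite: Zywina2015, Prop. 1.14 and Prop. 1.16 (§1.9)] [cite: Serre1972, §4.5] -/
theorem not_hasCM_of_surj_three [Fact (Nat.Prime 3)] (hsurj : Surj W 3) : ¬ W.HasCM :=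
  fun hCM ↦ W.not_hasSurjectiveModNGaloisRep_of_hasCM hCM Nat.prime_three (by decide) hsurj

/-! ### §2 The chain: ONE conjecture binder ⟹ the LOWER half, and its converse -/

/-- **U3-IW, rank `0`: the uniform conditional LOWER half at `3`.** For every globally minimal
`E/ℚ` of analytic rank `0`, additive at `3` and potentially ordinary there (`ord₃ j < 0`, or type
(G)-ordinary), off the CM rows and the anomalous rows of the (G)-part: the `T = 0` LOWER divisibility
of Delbourgo's Main Conjecture — `CycLowerLeadingTermAt W 3`: for every generator `f` of
`char_Λ X(E/ℚ_∞)`, `L(E,1)/Ω_E ∣ f(0)` in `ℤ₃`; the ONE conjecture binder, implied by the printed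
Main Conjecture (Compositio 113 p. 151, `ε(T)G_E(T) = ℓ_p(E)∫(1+T)^{x_p} dμ_E`, at `T = 0`: Thm. 1's
interpolation gives `∫dμ_E = ±α⁻¹L(E,1)/Ω_E` with `α ∈ ℤ_p^×`, and `ℓ_p(E) ∈ ℤ₃` because its only
denominator `c₃(E) = [E(ℚ₃) : E₀(ℚ₃)]` is prime to `3` on this locus, §1) — implies
`ord₃ #Ш(E)_an ≤ ord₃ #Ш(E)`. Printed inputs: Delbourgo 1998 Prop. 4 / §2.2 Lemma (ii) on (M)
(`hDelX`), Delbourgo 2002 (A)+(B) at `3` on (G) (`hDel3`), GZK, modularity.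
[cite: Delbourgo1998, Prop. 4 (p. 144), §2.2 Lemma (ii) (p. 139), Main Conjecture (p. 151; held p0029 L59–75)]
[cite: Delbourgo2002, Theorem (A), (B) (p. 40), Hypothesis second bullet (p. 39)] [cite: Miller2011LMS, Def. 1.1] -/
theorem missingLowerBoundAt_three_rankZero_of_cycLowerLeadingTerm [Fact (Nat.Prime 3)]
    (hDelX : Delbourgo1998.prop4_rankZero_constantCoeff_eq_unit_mul_of_potMult)
    (hDel3 : Delbourgo2002.mainTheorem_three)
    (hGZK : rank_eq_analyticRank_of_analyticRank_le_one) (hmod : hasEntireLFunction_rat)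
    (hadd : Addv W 3) (hord : Additive.PotMult W 3 ∨ TypeGOrd W 3) (hr : W.analyticRank = 0)
    (hcm : TypeGOrd W 3 → ¬ W.HasCM)
    (hna : TypeGOrd W 3 → Delbourgo2002.ReductionNonAnomalous W 3)
    (hMC : CycLowerLeadingTermAt W 3) : MissingLowerBoundAt W 3 := by
  rcases hord with hM | hG
  · exact missingLowerBoundAt_rankZero_of_potMult_of_cycLeadingTermDvd W 3 hDelX hGZK hmod (by decide)
      hadd hM hr ((cycLeadingTermDvdAt_iff_cycLowerLeadingTermAt W 3).mpr hMC)
  · exact hG.missingLowerBoundAt_three_rankZero_of_cycLower_of_nonAnomalous hDel3 hGZK hmod hadd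
      (hcm hG) hr (hna hG) hMC

/-- **Converse, rank `0`, on the WHOLE potentially-ordinary additive locus at `3`** (no CM and no
anomalous proviso): the lower half in Miller's currency gives back the `T = 0` divisibility —
Delbourgo 1998 Prop. 4 (`hDel`), GZK, modularity; the binder `3 ∤ c₃(E)` is §1's theorem.
[cite: Delbourgo1998, Prop. 4 (p. 144), Main Conjecture (p. 151)] [cite: Miller2011LMS, Def. 1.1] -/
theorem cycLowerLeadingTerm_of_missingLowerBoundAt_three_rankZero [Fact (Nat.Prime 3)]
    (hDel : Delbourgo1998.prop4_rankZero_pow_dvd_constantCoeff)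
    (hGZK : rank_eq_analyticRank_of_analyticRank_le_one) (hmod : hasEntireLFunction_rat)
    (hadd : Addv W 3) (hord : Additive.PotMult W 3 ∨ TypeGOrd W 3) (hr : W.analyticRank = 0)
    (hlow : MissingLowerBoundAt W 3) : CycLowerLeadingTermAt W 3 :=
  (cycLeadingTermDvdAt_iff_cycLowerLeadingTermAt W 3).mp
    (cycLeadingTermDvdAt_of_missingLowerBoundAt W 3 hDel hGZK hmod (by decide) hadd hord.symm hr
      (not_dvd_tamagawaNumberAt_three_of_potOrd hadd hord) hlow)

/-- **Exactness at the `Ш` level, rank `0`**: off the CM and anomalous rows of the (G)-part, the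
missing LOWER half at `3` IS the `T = 0` main-conjecture divisibility — `iff`, no slack either way.
[cite: Delbourgo1998, Prop. 4 (p. 144), Main Conjecture (p. 151)]
[cite: Delbourgo2002, Theorem (A), (B) (p. 40)] [cite: Miller2011LMS, Def. 1.1] -/
theorem missingLowerBoundAt_three_iff_cycLowerLeadingTerm_rankZero [Fact (Nat.Prime 3)]
    (hDel : Delbourgo1998.prop4_rankZero_pow_dvd_constantCoeff)
    (hDelX : Delbourgo1998.prop4_rankZero_constantCoeff_eq_unit_mul_of_potMult)
    (hDel3 : Delbourgo2002.mainTheorem_three)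
    (hGZK : rank_eq_analyticRank_of_analyticRank_le_one) (hmod : hasEntireLFunction_rat)
    (hadd : Addv W 3) (hord : Additive.PotMult W 3 ∨ TypeGOrd W 3) (hr : W.analyticRank = 0)
    (hcm : TypeGOrd W 3 → ¬ W.HasCM)
    (hna : TypeGOrd W 3 → Delbourgo2002.ReductionNonAnomalous W 3) :
    MissingLowerBoundAt W 3 ↔ CycLowerLeadingTermAt W 3 :=
  ⟨cycLowerLeadingTerm_of_missingLowerBoundAt_three_rankZero hDel hGZK hmod hadd hord hr,
    missingLowerBoundAt_three_rankZero_of_cycLowerLeadingTerm hDelX hDel3 hGZK hmod hadd hord hr hcm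
      hna⟩

/-! ### §3 Class N11 ∩ potentially ordinary (X4 ∧ `surj(3)` ∧ `r_an = 0`): `BSD(E,3)` from the one
binder, and the binder back from `BSD(E,3)` -/

/-- **N11-shaped LOWER half**: on X4 ∧ `surj(3)` ∧ `r_an = 0` ∧ potentially ordinary at `3`, off the
anomalous (G)-rows, the one binder gives `Typed.MissingLowerBoundAt W 3`; the non-CM binder of
Delbourgo 2002 is DISCHARGED by `surj(3)` (§1). [cite: Delbourgo2002, Theorem (A), (B) (p. 40)]
[cite: Delbourgo1998, Prop. 4 (p. 144), §2.2 Lemma (ii) (p. 139)] [cite: Miller2011LMS, Def. 1.1] -/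
theorem missingLowerBoundAt_three_rankZero_of_surj_of_cycLowerLeadingTerm [Fact (Nat.Prime 3)]
    (hDelX : Delbourgo1998.prop4_rankZero_constantCoeff_eq_unit_mul_of_potMult)
    (hDel3 : Delbourgo2002.mainTheorem_three)
    (hGZK : rank_eq_analyticRank_of_analyticRank_le_one) (hmod : hasEntireLFunction_rat)
    (hX : ClassX4 W 3) (hsurj : Surj W 3) (hord : Additive.PotMult W 3 ∨ TypeGOrd W 3)
    (hr : W.analyticRank = 0) (hna : TypeGOrd W 3 → Delbourgo2002.ReductionNonAnomalous W 3)
    (hMC : CycLowerLeadingTermAt W 3) : MissingLowerBoundAt W 3 :=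
  missingLowerBoundAt_three_rankZero_of_cycLowerLeadingTerm hDelX hDel3 hGZK hmod hX.2.1 hord hr
    (fun _ ↦ not_hasCM_of_surj_three hsurj) hna hMC

/-- **`BSD(E,3)` on N11 ∩ potentially ordinary from the ONE binder.** On X4 ∧ `surj(3)` ∧
`r_an = 0`, additive potentially ordinary at `3`, off the anomalous (G)-rows: the `T = 0` LOWER
divisibility `CycLowerLeadingTermAt W 3` implies Miller's `BSD(E,3)` — the UPPER half being the
tree's Kato `ω`-component readings at `3` (Kato Thm. 17.4 (3): `hKato` on (M) via Wuthrich's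
formulation, `hK` on (G)), Delbourgo 1998 Prop. 4 (`hDel`), GZK, modularity (`hmod`, `hmodD`).
[cite: Kato2004Asterisque, Thm. 17.4 (3) (p. 273)] [cite: Delbourgo1998, Prop. 4 (p. 144), Main Conjecture (p. 151)]
[cite: Delbourgo2002, Theorem (A), (B) (p. 40)] [cite: Miller2011LMS, §1 and Def. 1.1] -/
theorem bsdp_three_rankZero_of_surj_of_cycLowerLeadingTerm [Fact (Nat.Prime 3)]
    (hDel : Delbourgo1998.prop4_rankZero_pow_dvd_constantCoeff)
    (hDelX : Delbourgo1998.prop4_rankZero_constantCoeff_eq_unit_mul_of_potMult)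
    (hDel3 : Delbourgo2002.mainTheorem_three)
    (hKato : Wuthrich2014.kato_minusEigenCharIdeal_dvd_cyclotomicThree_of_surjective)
    (hK : Kato2004.charIdeal_dvd_padicLFunctionBranch_component_of_surjective)
    (hGZK : rank_eq_analyticRank_of_analyticRank_le_one) (hmod : hasEntireLFunction_rat)
    (hmodD : nonempty_modularParametrizationData)
    (hX : ClassX4 W 3) (hsurj : Surj W 3) (hord : Additive.PotMult W 3 ∨ TypeGOrd W 3)
    (hr : W.analyticRank = 0) (hna : TypeGOrd W 3 → Delbourgo2002.ReductionNonAnomalous W 3)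
    (hMC : CycLowerLeadingTermAt W 3) : BSDp W 3 := by
  have hlow := missingLowerBoundAt_three_rankZero_of_surj_of_cycLowerLeadingTerm hDelX hDel3 hGZK
    hmod hX hsurj hord hr hna hMC
  rcases hord with hM | hG
  · exact AdditivePotMult.ClassX4M.bsdp_three_rankZero_of_surj_of_lower' hDel hGZK hmod hmodD hKato
      ⟨hX, hX.2.1, hM⟩ hr hsurj hlow
  · exact ClassX4Gord.bsdp_three_of_katoComponent_of_surj_of_lower hK hDel hGZK hmod hmodD ⟨hX, hG⟩
      hr hsurj hlow

/-- **Exactness at the `BSD(E,3)` level**: on X4 ∧ `surj(3)` ∧ `r_an = 0`, additive potentially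
ordinary at `3`, off the anomalous (G)-rows, Miller's `BSD(E,3)` is EQUIVALENT to the `T = 0` LOWER
divisibility of Delbourgo's Main Conjecture — the IW lens' honest verdict as a theorem: on this
class there is no lever short of that Eisenstein-direction divisibility, and nothing more than it is
needed. [cite: Kato2004Asterisque, Thm. 17.4 (3) (p. 273)] [cite: Delbourgo1998, Prop. 4 (p. 144), Main Conjecture (p. 151)]
[cite: Delbourgo2002, Theorem (A), (B) (p. 40)] [cite: Miller2011LMS, §1 and Def. 1.1] -/
theorem bsdp_three_iff_cycLowerLeadingTerm_rankZero_of_surj [Fact (Nat.Prime 3)]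
    (hDel : Delbourgo1998.prop4_rankZero_pow_dvd_constantCoeff)
    (hDelX : Delbourgo1998.prop4_rankZero_constantCoeff_eq_unit_mul_of_potMult)
    (hDel3 : Delbourgo2002.mainTheorem_three)
    (hKato : Wuthrich2014.kato_minusEigenCharIdeal_dvd_cyclotomicThree_of_surjective)
    (hK : Kato2004.charIdeal_dvd_padicLFunctionBranch_component_of_surjective)
    (hGZK : rank_eq_analyticRank_of_analyticRank_le_one) (hmod : hasEntireLFunction_rat)
    (hmodD : nonempty_modularParametrizationData)
    (hX : ClassX4 W 3) (hsurj : Surj W 3) (hord : Additive.PotMult W 3 ∨ TypeGOrd W 3)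
    (hr : W.analyticRank = 0) (hna : TypeGOrd W 3 → Delbourgo2002.ReductionNonAnomalous W 3) :
    BSDp W 3 ↔ CycLowerLeadingTermAt W 3 := by
  refine ⟨fun hbsd ↦ ?_, bsdp_three_rankZero_of_surj_of_cycLowerLeadingTerm hDel hDelX hDel3 hKato hK
    hGZK hmod hmodD hX hsurj hord hr hna⟩
  haveI : Finite W.sha := (hGZK W (hr.le.trans zero_le_one)).2
  exact cycLowerLeadingTerm_of_missingLowerBoundAt_three_rankZero hDel hGZK hmod hX.2.1 hord hr
    (lower_and_upper_of_missingPPartAt W 3 (missingPPartAt_of_bsdp W 3 hbsd)).1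

/-! ### §4 Census-literal form of the (G)-ordinary class at `3`: a globally minimal model `V` of the
twist `E ⊗ χ_{−3}` which is GOOD at `3` with `3 ∤ a₃(V)` (ordinary: `TypeGOrd W 3`) and
`3 ∤ a₃(V) − 1` (non-anomalous: `ReductionNonAnomalous W 3`) — i.e. `a₃(V) ≡ 2 (mod 3)` -/

omit [W.IsElliptic] [W.IsGloballyMinimal] in
/-- Twisting twice by `−3` returns to the curve: from a presentation `C • V^{(−3)} = W` one gets a
presentation `C' • W^{(−3)} = V` (`(V^{(−3)})^{(−3)} = V^{(9)} ≅ V^{(1)} ≅ V`, Silverman *AEC* X.5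
Cor. 5.4). Bookkeeping for the two twist conventions of the tree's dictionaries at `3`. [folklore] -/
theorem exists_smul_quadraticTwist_neg_three_eq_symm (V : WeierstrassCurve ℚ)
    (hWV : ∃ C : VariableChange ℚ, C • V.quadraticTwist (-3) = W) :
    ∃ C' : VariableChange ℚ, C' • W.quadraticTwist (-3) = V := by
  obtain ⟨C, hC⟩ := hWV
  obtain ⟨C₁, hC₁⟩ := V.exists_variableChange_quadraticTwist_one
  obtain ⟨C₂, hC₂⟩ := V.exists_variableChange_quadraticTwist_mul_sq 1 3 three_ne_zero
  have h9 : W.quadraticTwist (-3) =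
      ((⟨C.u, -3 * C.r, 0, 0⟩ : VariableChange ℚ) * C₂ * C₁) • V := by
    rw [← hC, WeierstrassCurve.quadraticTwist_smul, quadraticTwist_quadraticTwist, mul_smul, mul_smul, hC₁, hC₂]
    norm_num
  exact ⟨((⟨C.u, -3 * C.r, 0, 0⟩ : VariableChange ℚ) * C₂ * C₁)⁻¹, by rw [h9, inv_smul_smul]⟩

omit [W.IsGloballyMinimal] in
/-- **Census-literal (G)-ordinary at `3`**: for `E` additive at `3` and a globally minimal model `V`
of `E ⊗ χ_{−3}` with good reduction at `3` and `3 ∤ a₃(V)`, the pair is of Delbourgo's type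
(G)-ordinary (`TypeGOrd W 3`: good ordinary over `ℚ(√−3) ⊆ ℚ(ζ₃)`) — the tree's dictionary
`typeGOrd_of_goodOrd_quadraticTwist` in the `C • V^{(−3)} = W` convention.
[cite: Delbourgo1998, §1.5 (G) (p. 130)] -/
theorem typeGOrd_three_of_good_twist_model [Fact (Nat.Prime 3)] (V : WeierstrassCurve ℚ)
    [V.IsElliptic] [V.IsGloballyMinimal] (hWV : ∃ C : VariableChange ℚ, C • V.quadraticTwist (-3) = W)
    (hV : V.HasGoodReductionAtPrime 3) (hordV : ¬ (3 : ℤ) ∣ V.frobeniusTrace 3) : TypeGOrd W 3 := by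
  obtain ⟨C', hC'⟩ := exists_smul_quadraticTwist_neg_three_eq_symm V hWV
  have hC'' : C' • W.quadraticTwist ((-1 : ℚ) ^ ((3 : ℕ) / 2) * (3 : ℕ)) = V := by
    norm_num
    exact hC'
  exact typeGOrd_of_goodOrd_quadraticTwist W 3 (by decide) V C' hC'' ⟨hV, by exact_mod_cast hordV⟩

/-- **U3-IW on N11's (G)-ordinary rows, census-literal class predicate**: X4 at `3`, `surj(3)`,
`r_an = 0`, and a globally minimal model `V` of `E ⊗ χ_{−3}` good at `3` with `a₃(V) ≡ 2 (mod 3)`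
(`3 ∤ a₃(V)`: ordinary; `3 ∤ a₃(V) − 1`: non-anomalous) — the ONE binder `CycLowerLeadingTermAt W 3`
gives `Typed.MissingLowerBoundAt W 3`. Every class binder is a Cremona-table datum of `E` and its
`−3`-twist; the only non-printed input is the conjecture binder.
[cite: Delbourgo2002, Theorem (A), (B) (p. 40), Hypothesis second bullet (p. 39)]
[cite: Delbourgo1998, Main Conjecture (p. 151)] [cite: Miller2011LMS, Def. 1.1] -/
theorem missingLowerBoundAt_three_rankZero_of_good_twist_of_cycLowerLeadingTerm [Fact (Nat.Prime 3)]
    (hDelX : Delbourgo1998.prop4_rankZero_constantCoeff_eq_unit_mul_of_potMult)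
    (hDel3 : Delbourgo2002.mainTheorem_three)
    (hGZK : rank_eq_analyticRank_of_analyticRank_le_one) (hmod : hasEntireLFunction_rat)
    (hX : ClassX4 W 3) (hsurj : Surj W 3) (hr : W.analyticRank = 0)
    (V : WeierstrassCurve ℚ) [V.IsElliptic] [V.IsGloballyMinimal]
    (hWV : ∃ C : VariableChange ℚ, C • V.quadraticTwist (-3) = W) (hV : V.HasGoodReductionAtPrime 3)
    (hordV : ¬ (3 : ℤ) ∣ V.frobeniusTrace 3) (hnaV : ¬ (3 : ℤ) ∣ V.frobeniusTrace 3 - 1)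
    (hMC : CycLowerLeadingTermAt W 3) : MissingLowerBoundAt W 3 :=
  have hG : TypeGOrd W 3 := typeGOrd_three_of_good_twist_model V hWV hV hordV
  missingLowerBoundAt_three_rankZero_of_surj_of_cycLowerLeadingTerm hDelX hDel3 hGZK hmod hX hsurj
    (Or.inr hG) hr (fun _ ↦ reductionNonAnomalous_three_of_typeG_of_not_dvd hG.typeG hX.2.1 V hWV hV
      hnaV) hMC

/-- **`BSD(E,3) ↔` the ONE binder, census-literal (G)-ordinary class at `3`** (X4, `surj(3)`,
`r_an = 0`, `V ≅ E ⊗ χ_{−3}` good at `3` with `a₃(V) ≡ 2 (mod 3)`).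
[cite: Kato2004Asterisque, Thm. 17.4 (3) (p. 273)] [cite: Delbourgo1998, Prop. 4 (p. 144), Main Conjecture (p. 151)]
[cite: Delbourgo2002, Theorem (A), (B) (p. 40)] [cite: Miller2011LMS, §1 and Def. 1.1] -/
theorem bsdp_three_iff_cycLowerLeadingTerm_rankZero_of_good_twist [Fact (Nat.Prime 3)]
    (hDel : Delbourgo1998.prop4_rankZero_pow_dvd_constantCoeff)
    (hDelX : Delbourgo1998.prop4_rankZero_constantCoeff_eq_unit_mul_of_potMult)
    (hDel3 : Delbourgo2002.mainTheorem_three)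
    (hKato : Wuthrich2014.kato_minusEigenCharIdeal_dvd_cyclotomicThree_of_surjective)
    (hK : Kato2004.charIdeal_dvd_padicLFunctionBranch_component_of_surjective)
    (hGZK : rank_eq_analyticRank_of_analyticRank_le_one) (hmod : hasEntireLFunction_rat)
    (hmodD : nonempty_modularParametrizationData)
    (hX : ClassX4 W 3) (hsurj : Surj W 3) (hr : W.analyticRank = 0)
    (V : WeierstrassCurve ℚ) [V.IsElliptic] [V.IsGloballyMinimal]
    (hWV : ∃ C : VariableChange ℚ, C • V.quadraticTwist (-3) = W) (hV : V.HasGoodReductionAtPrime 3)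
    (hordV : ¬ (3 : ℤ) ∣ V.frobeniusTrace 3) (hnaV : ¬ (3 : ℤ) ∣ V.frobeniusTrace 3 - 1) :
    BSDp W 3 ↔ CycLowerLeadingTermAt W 3 :=
  have hG : TypeGOrd W 3 := typeGOrd_three_of_good_twist_model V hWV hV hordV
  bsdp_three_iff_cycLowerLeadingTerm_rankZero_of_surj hDel hDelX hDel3 hKato hK hGZK hmod hmodD hX hsurj
    (Or.inr hG) hr (fun _ ↦ reductionNonAnomalous_three_of_typeG_of_not_dvd hG.typeG hX.2.1 V hWV hV
      hnaV)

/-! ### §5 The `∀`-closures: the class-level LOWER conjecture at `3` IS the class-level `T = 0`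
Eisenstein divisibility (inline `∀` hypotheses, no new `def`; the b2b style of
`N10.lowerHalfM_of_forall_cycLeadingTermDvd`) -/

/-- **Class level, `Ш` currency**: "`ord₃ #Ш_an ≤ ord₃ #Ш` on every rank-`0` potentially-ordinary
additive row at `3` (off CM / anomalous (G)-rows)" is EQUIVALENT to "the `T = 0` LOWER divisibility of
Delbourgo's Main Conjecture on every such row" — granted the printed inputs `hDel`, `hDelX`, `hDel3`,
GZK, modularity. So the uniform conjecture U3 asks for on this class is, in the kernel, exactly one
`∀`-closure of `CycLowerLeadingTermAt W 3`. [cite: Delbourgo1998, Prop. 4 (p. 144), Main Conjecture (p. 151)]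
[cite: Delbourgo2002, Theorem (A), (B) (p. 40)] [cite: Miller2011LMS, Def. 1.1] -/
theorem forall_missingLowerBoundAt_three_iff_forall_cycLowerLeadingTerm_rankZero [Fact (Nat.Prime 3)]
    (hDel : Delbourgo1998.prop4_rankZero_pow_dvd_constantCoeff)
    (hDelX : Delbourgo1998.prop4_rankZero_constantCoeff_eq_unit_mul_of_potMult)
    (hDel3 : Delbourgo2002.mainTheorem_three)
    (hGZK : rank_eq_analyticRank_of_analyticRank_le_one) (hmod : hasEntireLFunction_rat) :
    (∀ (W : WeierstrassCurve ℚ) [W.IsElliptic] [W.IsGloballyMinimal],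
        W.analyticRank = 0 → Addv W 3 → (Additive.PotMult W 3 ∨ TypeGOrd W 3) →
        (TypeGOrd W 3 → ¬ W.HasCM) → (TypeGOrd W 3 → Delbourgo2002.ReductionNonAnomalous W 3) →
        MissingLowerBoundAt W 3) ↔
      (∀ (W : WeierstrassCurve ℚ) [W.IsElliptic] [W.IsGloballyMinimal],
        W.analyticRank = 0 → Addv W 3 → (Additive.PotMult W 3 ∨ TypeGOrd W 3) →
        (TypeGOrd W 3 → ¬ W.HasCM) → (TypeGOrd W 3 → Delbourgo2002.ReductionNonAnomalous W 3) →
        CycLowerLeadingTermAt W 3) :=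
  ⟨fun h W _ _ hr hadd hord hcm hna ↦
      cycLowerLeadingTerm_of_missingLowerBoundAt_three_rankZero hDel hGZK hmod hadd hord hr
        (h W hr hadd hord hcm hna),
    fun h W _ _ hr hadd hord hcm hna ↦
      missingLowerBoundAt_three_rankZero_of_cycLowerLeadingTerm hDelX hDel3 hGZK hmod hadd hord hr hcm hna
        (h W hr hadd hord hcm hna)⟩

/-- **Class level, `BSD(E,3)` currency, N11 ∩ potentially ordinary**: "Miller's `BSD(E,3)` on every
X4 ∧ `surj(3)` ∧ `r_an = 0` potentially-ordinary additive row at `3` (off the anomalous (G)-rows)" is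
EQUIVALENT to the same `∀`-closure of the `T = 0` Eisenstein divisibility — granted additionally the
Kato `ω`-component readings (`hKato`, `hK`) and `hmodD`. A conductor-free `3`-part of BSD on this class
needs EXACTLY that one conjecture and nothing else. [cite: Kato2004Asterisque, Thm. 17.4 (3) (p. 273)]
[cite: Delbourgo1998, Prop. 4 (p. 144), Main Conjecture (p. 151)] [cite: Delbourgo2002, Theorem (A), (B) (p. 40)]
[cite: Miller2011LMS, §1 and Def. 1.1] -/
theorem forall_bsdp_three_iff_forall_cycLowerLeadingTerm_rankZero_of_surj [Fact (Nat.Prime 3)]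
    (hDel : Delbourgo1998.prop4_rankZero_pow_dvd_constantCoeff)
    (hDelX : Delbourgo1998.prop4_rankZero_constantCoeff_eq_unit_mul_of_potMult)
    (hDel3 : Delbourgo2002.mainTheorem_three)
    (hKato : Wuthrich2014.kato_minusEigenCharIdeal_dvd_cyclotomicThree_of_surjective)
    (hK : Kato2004.charIdeal_dvd_padicLFunctionBranch_component_of_surjective)
    (hGZK : rank_eq_analyticRank_of_analyticRank_le_one) (hmod : hasEntireLFunction_rat)
    (hmodD : nonempty_modularParametrizationData) :
    (∀ (W : WeierstrassCurve ℚ) [W.IsElliptic] [W.IsGloballyMinimal],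
        ClassX4 W 3 → Surj W 3 → W.analyticRank = 0 → (Additive.PotMult W 3 ∨ TypeGOrd W 3) →
        (TypeGOrd W 3 → Delbourgo2002.ReductionNonAnomalous W 3) → BSDp W 3) ↔
      (∀ (W : WeierstrassCurve ℚ) [W.IsElliptic] [W.IsGloballyMinimal],
        ClassX4 W 3 → Surj W 3 → W.analyticRank = 0 → (Additive.PotMult W 3 ∨ TypeGOrd W 3) →
        (TypeGOrd W 3 → Delbourgo2002.ReductionNonAnomalous W 3) → CycLowerLeadingTermAt W 3) :=
  ⟨fun h W _ _ hX hsurj hr hord hna ↦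
      (bsdp_three_iff_cycLowerLeadingTerm_rankZero_of_surj hDel hDelX hDel3 hKato hK hGZK hmod hmodD hX
        hsurj hord hr hna).mp (h W hX hsurj hr hord hna),
    fun h W _ _ hX hsurj hr hord hna ↦
      (bsdp_three_iff_cycLowerLeadingTerm_rankZero_of_surj hDel hDelX hDel3 hKato hK hGZK hmod hmodD hX
        hsurj hord hr hna).mpr (h W hX hsurj hr hord hna)⟩

/-! ### §6 The same binder one level up: the Λ-adic `ω`-branch conjecture for the semistable twist -/

/-- **Λ-level form of the ONE binder.** If every globally minimal model `V` of the semistable twist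
`E ⊗ χ_{−3}` satisfies the tree's `@[conjecture]` `QuadraticBranchLowerDivisibilityAt V 3` — the
Skinner–Urban-direction divisibility on the `ω = χ_{−3}`-eigencomponent of `X(V/ℚ(μ_{3^∞}))` by the
minus-branch `3`-adic `L`-function of `f_V` (good ordinary, split or non-split multiplicative at `3`;
NOT in print: S–U 2014 Thm. 3.6.4 is the trivial branch, `p ∤ N`) — then the `T = 0` binder
`CycLowerLeadingTermAt W 3` holds, on the WHOLE potentially-ordinary additive locus at `3` (image-free:
X3 and X4 rows alike). Descent = the tree's `chiBranchLowerLeadingTermOddAt_of_quadraticBranchLower`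
(odd branch, `3 ≡ 3 (mod 4)`) followed by the Birch–Pal transport to the Néron period (Pal 2012 Thm. 3.2
for `d < 0`, PROVED in the tree; modularity `hmod`, parametrisation data `hmodD`). Hence every theorem
of §2–§5 holds verbatim with this Λ-adic binder in place of A0.
[cite: SkinnerUrban2014, Thm. 3.6.4 (p. 43) (shape only; nothing asserted)] [cite: Pal2012, Thm. 3.2]
[cite: MazurTateTeitelbaum1986Invent, §I.10, §I.13–I.14] [cite: Delbourgo1998, Main Conjecture (p. 151) (shape)] -/
theorem cycLowerLeadingTerm_three_of_quadraticBranchLower [Fact (Nat.Prime 3)]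
    (hmod : hasEntireLFunction_rat) (hmodD : nonempty_modularParametrizationData)
    (hadd : Addv W 3) (hord : Additive.PotMult W 3 ∨ TypeGOrd W 3)
    (hΛ : ∀ (V : WeierstrassCurve ℚ) [V.IsElliptic] [V.IsGloballyMinimal],
      (∃ C : VariableChange ℚ, C • V.quadraticTwist (-3 : ℚ) = W) →
        QuadraticBranchLowerDivisibilityAt V 3) :
    CycLowerLeadingTermAt W 3 := by
  have h3 : ((-1 : ℚ) ^ (3 / 2) * ((3 : ℕ) : ℚ)) = -3 := by norm_num
  have hLow : ChiBranchLowerLeadingTermOddAt W 3 :=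
    chiBranchLowerLeadingTermOddAt_of_quadraticBranchLower W 3 fun V _ _ hCW ↦ hΛ V (by
      obtain ⟨C, hC⟩ := hCW
      exact ⟨C, by rwa [h3] at hC⟩)
  rcases hord with hM | hG
  · by_cases hirr : Irr W 3
    · exact (AdditivePotMult.ClassX4M.cycLowerLeadingTermAt_iff_chiBranchLowerOdd hmod hmodD
        ⟨⟨by decide, hadd, hirr⟩, hadd, hM⟩ (by decide)).mpr hLow
    · exact (AdditivePotMult.ClassX3M.cycLowerLeadingTermAt_iff_chiBranchLowerOdd hmod hmodD
        ⟨⟨hirr, hadd⟩, ⟨hadd, hM⟩, by decide⟩ (by decide)).mpr hLow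
  · exact (cycLowerLeadingTermAt_iff_chiBranchLowerOdd_of_typeGOrd_of_semistabilityIndex_eq_two W 3
      hmod hmodD (by decide) hadd hG (semistabilityIndex_eq_two_of_typeG_three W hG.typeG hadd)).mpr hLow

end Summit.BirchSwinnertonDyer.Uniform.U3

end
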